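import Summits.BirchSwinnertonDyer.BirchSwinnertonDyer.Theorems.GenusKolyvaginAtTwoGenusPrimitiveSupplyAtTwoTwistMenuFrame
import Summits.BirchSwinnertonDyer.BirchSwinnertonDyer.Theorems.GenusKolyvaginAtTwoGenusPrimitiveSupplyAtTwoArchimedeanDescAdmissible
import HarnessLib

/-!
# Route `GenusKolyvaginAtTwo`, crux #2 `GenusPrimitiveSupplyAtTwo` (stmt-BirchSwinnertonDyer-22136):
# Mazur–Rubin Prop. 3.3 with a FINITE SET `T` of ramified good odd places (the `V_T`-free consequences) for the CANONICAL
# identification — `|d₂(E^F) − d₂(E)| ≤ #T` and `d₂(E^F) ≡ d₂(E) + #T (mod 2)`, unconditional, every number field, every `E`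

Width seat `bsd-line-gk2-p4` g12 (cell `bsd-f1-sign2`), sequel of `…TwistMenuFrame` (§79: `T = {v₀}`). THEOREMS ONLY (no definition, no
named fact, no `sorry`); helper `--supports stmt-BirchSwinnertonDyer-22136`; no item is closed; BSD is not proved by any of this.

WHAT.
* §80 `natCard_selmerGroup_le_mul_prod_of_agree_off` — the ELEMENTARY transfer bound for two Selmer structures `𝓐, 𝓑` on `E[p]` that agree
  off a finite set `S`: `#H¹_𝓐 ≤ #H¹_𝓑 · ∏_{v∈S} #𝓐_v` (the kernel of `H¹_𝓐 → ⊕_{v∈S} H¹(K_v, E[p])` lies in `H¹_𝓑`, the image in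
  `⊕ 𝓐_v`); no duality.
* §81 `isSquare_two_pow_iff_even` — `2ⁿ` is a square iff `n` is even.
* §82 **`natCard_selmerGroup_twist_bounds_of_menu_frame`** — for `W/K`, `Wd = C • W^{(d)}`, a finite set `T` of places `v ∤ 2` of good
  reduction for `W`, ramified in `K(√d)`, with `#W(K_v)[2] = 2`, every finite `v ∉ T` on the FOUR-row menu and every infinite place on the
  two-row menu: **`#Sel₂(Wd) ≤ 2^{#T}·#Sel₂(W)`, `#Sel₂(W) ≤ 2^{#T}·#Sel₂(Wd)`, and `#Sel₂(Wd)·#Sel₂(W)·2^{#T}` is a square** — Mazur–Rubin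
  Prop. 3.3's `V_T`-free consequences (`d₂(E^F) = d₂(E) − dim V_T + d`, `0 ≤ d ≤ #T − dim V_T`, `d ≡ #T − dim V_T`) as they are vendored over
  `ℚ` in `MazurRubin2010.prop33_rat`; inputs: the menus (Lemma 2.10), Lemma 2.11 and the frame datum for ONE identification
  (`exists_intertwining_hsplit_and_transverse_frame`), the elementary bound §80 (for the inequalities), and Kramer's congruence for the FRAMED
  identification (part 9, for the parity) — PT with real places and Tate χ fed by tree theorems. No Galois-image hypothesis.

References: [MazurRubin2010] Lemma 2.2 (i), Lemmas 2.9–2.11, Def. 3.1, Prop. 3.3; [Kramer1981] Thm. 1; [KlagsbrunMazurRubin2013] Thm. 3.9,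
Lemma 5.2; [MilneADT2006] I Lemma 3.3, Thm. 2.8, 4.10.
-/

set_option linter.dupNamespace false -- tree convention: `Summit.BirchSwinnertonDyer.BirchSwinnertonDyer.Theorems` (summit = sub-problem)
set_option autoImplicit false

noncomputable section

open scoped Classical ContRepresentation

namespace Summit.BirchSwinnertonDyer.BirchSwinnertonDyer.Theorems.GenusKolyTwistLocal

open WeierstrassCurve Field NumberField IsDedekindDomain Function
open Literature.NumberTheory.EllipticCurves Literature.NumberTheory.GaloisRepresentations
open Literature.NumberTheory.EllipticCurves.DokchitserDokchitser2012 (T xT)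
open Literature.NumberTheory.GaloisRepresentations.IsNonarchimedeanLocalField
open Literature.NumberTheory.GaloisRepresentations.DiscreteGaloisModule (SelmerStructure)
open Literature.NumberTheory.GaloisCohomology
open Summit.BirchSwinnertonDyer.Rank1Residual.X11b
open Summit.BirchSwinnertonDyer.Rank1Residual.X11b.CongruentTransfer
open Summit.BirchSwinnertonDyer.BirchSwinnertonDyer.Theorems.GenusKolyTwistTamagawa
  (transport_twist_agree_inr_of_menu transport_twist_agree_inl_of_menu)
open Summit.BirchSwinnertonDyer.BirchSwinnertonDyer.Theorems.GenusKolyArch (natCard_ker_nsmul_eq_of_intertwining)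

/-! ## §80 The elementary transfer bound -/

section Bound

variable {K : Type} [Field K] [NumberField K] (W : WeierstrassCurve K) [W.IsElliptic] (p : ℕ) [hp : Fact p.Prime]

/-- **Elementary transfer bound.** For two Selmer structures `𝓐, 𝓑` on `E[p]` agreeing off a finite set of places `S`, with `H¹_𝓑`
finite: `#H¹_𝓐 ≤ #H¹_𝓑 · ∏_{v∈S} #𝓐_v` — the kernel of the localisation `H¹_𝓐 → ⊕_{v∈S} H¹(K_v, E[p])` consists of classes that are
`0 ∈ 𝓑_v` at `v ∈ S` and in `𝓐_v = 𝓑_v` off `S`, so it lies in `H¹_𝓑`; the image lies in `⊕_{v∈S} 𝓐_v`. No duality.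
[cite: MazurRubin2010, proof of Prop. 3.3 (the sandwich S_T ⊂ Sel ⊂ S^T)] -/
theorem natCard_selmerGroup_le_mul_prod_of_agree_off (𝓐 𝓑 : SelmerStructure (W.torsionGaloisModule (p : ℤ)))
    (S : Finset (Place K)) (hagree : ∀ v ∉ S, 𝓐 v = 𝓑 v) [Finite 𝓑.selmerGroup] :
    Nat.card 𝓐.selmerGroup ≤ Nat.card 𝓑.selmerGroup * ∏ v ∈ S, Nat.card (𝓐 v) := by
  haveI : NeZero p := ⟨hp.out.ne_zero⟩
  let M := W.torsionGaloisModule (p : ℤ)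
  haveI hfinL : ∀ v : Place K, Finite (galoisCohomology (M.toLocal v) 1) := fun v ↦
    GenusKolyKramer.finite_galoisCohomology_toLocal W p v
  -- the localisation at the places of `S`
  let f : 𝓐.selmerGroup →+ ((v : S) → galoisCohomology (M.toLocal (v : Place K)) 1) :=
    AddMonoidHom.pi fun v : S ↦ (galoisCohomology.localization M (v : Place K) 1).comp 𝓐.selmerGroup.subtype
  have hf : ∀ (c : 𝓐.selmerGroup) (v : S), f c v = galoisCohomology.localization M (v : Place K) 1 (c : galoisCohomology M 1) :=
    fun _ _ ↦ rfl
  -- the kernel lies in `H¹_𝓑`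
  have hker : Nat.card f.ker ≤ Nat.card 𝓑.selmerGroup := by
    refine Nat.card_le_card_of_injective (fun c ↦ ⟨((c : 𝓐.selmerGroup) : galoisCohomology M 1), ?_⟩) ?_
    · rw [𝓑.mem_selmerGroup_iff]
      intro v
      by_cases hv : v ∈ S
      · have h0 : f (c : 𝓐.selmerGroup) ⟨v, hv⟩ = 0 := by
          have := c.2
          rw [AddMonoidHom.mem_ker] at this
          rw [this]; rfl
        rw [hf] at h0
        rw [h0]
        exact zero_mem _
      · rw [← hagree v hv]
        exact (𝓐.mem_selmerGroup_iff _).mp (c : 𝓐.selmerGroup).2 v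
    · intro c c' h
      apply Subtype.ext; apply Subtype.ext
      simpa using congrArg Subtype.val h
  -- the image lies in `⊕_{v∈S} 𝓐_v`
  haveI : ∀ v : S, Finite (𝓐 (v : Place K)) := fun v ↦ inferInstance
  have hrange : Nat.card f.range ≤ ∏ v ∈ S, Nat.card (𝓐 v) := by
    have hpi : Nat.card ((v : S) → 𝓐 (v : Place K)) = ∏ v ∈ S, Nat.card (𝓐 v) := by
      rw [Nat.card_pi, Finset.prod_coe_sort S (fun v ↦ Nat.card (𝓐 v))]
    rw [← hpi]
    refine Nat.card_le_card_of_injective (fun x ↦ fun v ↦ ⟨(x : (v : S) → galoisCohomology (M.toLocal (v : Place K)) 1) v, ?_⟩) ?_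
    · obtain ⟨c, hc⟩ := x.2
      rw [← hc, hf]
      exact (𝓐.mem_selmerGroup_iff _).mp c.2 (v : Place K)
    · intro x y h
      apply Subtype.ext
      funext v
      exact congrArg (fun g ↦ ((g v : 𝓐 (v : Place K)) : galoisCohomology (M.toLocal (v : Place K)) 1)) h
  -- `#H¹_𝓐 = #ker · #range`
  have hcard : Nat.card 𝓐.selmerGroup = Nat.card f.ker * Nat.card f.range := by
    rw [AddSubgroup.card_eq_card_quotient_mul_card_addSubgroup f.ker, mul_comm,
      Nat.card_congr (QuotientAddGroup.quotientKerEquivRange f).toEquiv]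
  rw [hcard]
  exact Nat.mul_le_mul hker hrange

/-! ## §81 Squares among powers of two -/

omit hp in
/-- `2ⁿ` is a perfect square iff `n` is even. [folklore] -/
theorem isSquare_two_pow_iff_even (n : ℕ) : IsSquare (2 ^ n) ↔ Even n := by
  constructor
  · rintro ⟨r, hr⟩
    have hdvd : r ∣ 2 ^ n := ⟨r, hr⟩
    obtain ⟨k, -, rfl⟩ := (Nat.dvd_prime_pow Nat.prime_two).mp hdvd
    rw [← pow_add] at hr
    exact ⟨k, Nat.pow_right_injective le_rfl hr⟩
  · rintro ⟨k, rfl⟩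
    exact ⟨2 ^ k, by rw [← pow_add]⟩

end Bound

/-! ## §82 Prop. 3.3 with a finite set of `T`-places, for a FRAMED identification — unconditional -/

section Multi

variable {K : Type} [Field K] [NumberField K] (W Wd : WeierstrassCurve K) [W.IsElliptic] [Wd.IsElliptic]

/-- **MAZUR–RUBIN PROP. 3.3 (the `V_T`-free consequences) WITH A FINITE SET OF `T`-PLACES — UNCONDITIONAL, every number field, every
elliptic `W`, the canonical identification.** Data: `Wd = C • W^{(d)}`; a finite set `T` of places `v ∤ 2` of good reduction for `W`, each
RAMIFIED in `K(√d)` (`ι(√d) ∉ K_v^{nr}`) with `#W(K_v)[2] = 2`; every finite `v ∉ T` on the FOUR-row menu (split ∨ odd with both local Tamagawa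
numbers odd ∨ odd & good for both ∨ odd & silent for both); every infinite place split or with `H¹ = 0` for both. Conclusion:
`#Sel₂(Wd) ≤ 2^{#T}·#Sel₂(W)`, `#Sel₂(W) ≤ 2^{#T}·#Sel₂(Wd)`, and `IsSquare (#Sel₂(Wd)·#Sel₂(W)·2^{#T})`. The inequalities are the
elementary bound §80 (each `T`-place contributes `#𝓐_v = #𝓚_v = 2`); the parity is Kramer's congruence for the framed identification
(part 9) with `[𝓚_v : 𝓐_v ⊓ 𝓚_v] = #𝓚_v = 2` by Lemma 2.11. [cite: MazurRubin2010, Prop. 3.3 with Lemmas 2.2 (i), 2.9–2.11]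
[cite: Kramer1981, Thm. 1] [cite: MilneADT2006, I Lemma 3.3, Thm. 2.8, 4.10] -/
theorem natCard_selmerGroup_twist_bounds_of_menu_frame {d : K} (hd : d ≠ 0) {C : VariableChange K}
    (hWd : C • W.quadraticTwist d = Wd) (T : Finset (HeightOneSpectrum (𝓞 K)))
    (hT2 : ∀ v ∈ T, ((2 : ℕ) : 𝓞 K) ∉ v.asIdeal) (hTgood : ∀ v ∈ T, W.HasGoodReductionAt v)
    (hTram : ∀ v ∈ T, closureEmb (K := K) (v.adicCompletion K) (geomSqrt d) ∉ maxUnramified (v.adicCompletion K))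
    (hTt : ∀ v ∈ T, Nat.card (nsmulAddMonoidHom 2 : (W.baseChange (v.adicCompletion K)).toAffine.Point →+ _).ker = 2)
    (hfin : ∀ v : HeightOneSpectrum (𝓞 K), v ∉ T →
      (∃ s : v.adicCompletion K, s ^ 2 = algebraMap K (v.adicCompletion K) d) ∨
      (((2 : ℕ) : 𝓞 K) ∉ v.asIdeal ∧
        ¬ 2 ∣ (W.baseChange (v.adicCompletion K)).localTamagawaNumber (v.adicCompletionIntegers K) ∧
        ¬ 2 ∣ (Wd.baseChange (v.adicCompletion K)).localTamagawaNumber (v.adicCompletionIntegers K)) ∨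
      (((2 : ℕ) : 𝓞 K) ∉ v.asIdeal ∧ W.HasGoodReductionAt v ∧ Wd.HasGoodReductionAt v) ∨
      (((2 : ℕ) : 𝓞 K) ∉ v.asIdeal ∧
        Nat.card (nsmulAddMonoidHom 2 : (W.baseChange (v.adicCompletion K)).toAffine.Point →+ _).ker = 1 ∧
        Nat.card (nsmulAddMonoidHom 2 : (Wd.baseChange (v.adicCompletion K)).toAffine.Point →+ _).ker = 1))
    (hinf : ∀ w : InfinitePlace K,
      (∃ s : w.Completion, s ^ 2 = algebraMap K w.Completion d) ∨
      ((∀ x : galoisCohomology (W.localGaloisModule w.Completion) 1, x = 0) ∧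
        (∀ x : galoisCohomology (Wd.localGaloisModule w.Completion) 1, x = 0))) :
    Nat.card (Wd.selmerGroup ((2 : ℕ) : ℤ)) ≤ 2 ^ T.card * Nat.card (W.selmerGroup ((2 : ℕ) : ℤ)) ∧
    Nat.card (W.selmerGroup ((2 : ℕ) : ℤ)) ≤ 2 ^ T.card * Nat.card (Wd.selmerGroup ((2 : ℕ) : ℤ)) ∧
    IsSquare (Nat.card (Wd.selmerGroup ((2 : ℕ) : ℤ)) * Nat.card (W.selmerGroup ((2 : ℕ) : ℤ)) * 2 ^ T.card) := by
  haveI : Fact (Nat.Prime 2) := ⟨Nat.prime_two⟩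
  -- the canonical identification: split agreement, Lemma 2.11, frame datum
  obtain ⟨φ, ψ, hψφ, hφψ, hsplit, htr, π, A, hπ, hA⟩ := exists_intertwining_hsplit_and_transverse_frame W Wd hd hWd
  let 𝓐 : SelmerStructure (W.torsionGaloisModule ((2 : ℕ) : ℤ)) := fun v ↦
    (Wd.kummerSelmerStructure ((2 : ℕ) : ℤ) v).map (galoisCohomology.map (φ.restrictField (Place.Completion v)) 1)
  have h𝓐 : ∀ v, 𝓐 v = (Wd.kummerSelmerStructure ((2 : ℕ) : ℤ) v).map
      (galoisCohomology.map (φ.restrictField (Place.Completion v)) 1) := fun _ ↦ rfl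
  -- the `T`-places as places
  let S : Finset (Place K) := T.map ⟨Sum.inr, Sum.inr_injective⟩
  have hS_card : S.card = T.card := Finset.card_map _
  have hmemS : ∀ v : Place K, v ∈ S ↔ ∃ v' ∈ T, Sum.inr v' = v := fun v ↦ by
    simp only [S, Finset.mem_map, Function.Embedding.coeFn_mk]
  -- agreement off `S` from the menus
  have hagree : ∀ v ∉ S, 𝓐 v = W.kummerSelmerStructure ((2 : ℕ) : ℤ) v := by
    rintro (w | v) hv
    · exact transport_twist_agree_inl_of_menu W φ ψ hφψ hsplit 𝓐 h𝓐 w (hinf w)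
    · have hvT : v ∉ T := fun h ↦ hv ((hmemS _).mpr ⟨v, h, rfl⟩)
      exact transport_twist_agree_inr_of_menu W φ ψ hφψ hsplit 𝓐 h𝓐 v (hfin v hvT)
  -- the local counts at the `T`-places: `#𝓚_v = #𝓐_v = 2`, `[𝓚_v : 𝓐_v ⊓ 𝓚_v] = 2`
  have hKv : ∀ v ∈ T, Nat.card (W.kummerSelmerStructure ((2 : ℕ) : ℤ) (Sum.inr v)) = 2 := fun v hv ↦ by
    rw [W.natCard_kummerSelmerStructure_inr v two_ne_zero, hTt v hv, natCard_quotient_span_natCast_eq_one_of_not_mem v (hT2 v hv),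
      mul_one]
  have hAv : ∀ v ∈ T, Nat.card (𝓐 (Sum.inr v)) = 2 := fun v hv ↦ by
    haveI : CharZero (v.adicCompletion K) := charZero_of_injective_algebraMap (algebraMap K _).injective
    have h1 : Nat.card (𝓐 (Sum.inr v)) = Nat.card (Wd.kummerSelmerStructure ((2 : ℕ) : ℤ) (Sum.inr v)) := by
      rw [h𝓐]
      exact Nat.card_congr (AddSubgroup.equivMapOfInjective _ _
        (map_restrictField_injective_of_comp_eq φ ψ hψφ (Sum.inr v))).toEquiv.symm
    rw [h1, Wd.natCard_kummerSelmerStructure_inr v two_ne_zero,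
      natCard_ker_nsmul_eq_of_intertwining W Wd 2 two_ne_zero φ ψ hψφ hφψ (v.adicCompletion K), hTt v hv,
      natCard_quotient_span_natCast_eq_one_of_not_mem v (hT2 v hv), mul_one]
  have hrel : ∀ v ∈ T, (𝓐 (Sum.inr v)).relIndex (W.kummerSelmerStructure ((2 : ℕ) : ℤ) (Sum.inr v)) = 2 := fun v hv ↦ by
    have htr' : 𝓐 (Sum.inr v) ⊓ W.kummerSelmerStructure ((2 : ℕ) : ℤ) (Sum.inr v) = ⊥ := by
      rw [h𝓐, kummerSelmerStructure_apply, kummerSelmerStructure_apply]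
      exact htr v (hTgood v hv) (hT2 v hv) (hTram v hv)
    rw [← AddSubgroup.inf_relIndex_right, htr', AddSubgroup.relIndex_bot_left]
    exact hKv v hv
  -- Selmer cardinalities
  have hSelA : Nat.card 𝓐.selmerGroup = Nat.card (Wd.selmerGroup ((2 : ℕ) : ℤ)) :=
    natCard_selmerGroup_transport_kummer W Wd 2 φ ψ hψφ hφψ 𝓐 h𝓐
  have hSelK : Nat.card (W.kummerSelmerStructure ((2 : ℕ) : ℤ)).selmerGroup = Nat.card (W.selmerGroup ((2 : ℕ) : ℤ)) := by
    rw [selmerGroup_eq_selmerGroup_kummerSelmerStructure]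
    rfl
  have hfinW : Finite (W.selmerGroup ((2 : ℕ) : ℤ)) := W.finite_selmerGroup_holds (by norm_num)
  have hfinWd : Finite (Wd.selmerGroup ((2 : ℕ) : ℤ)) := Wd.finite_selmerGroup_holds (by norm_num)
  haveI hfinK : Finite (W.kummerSelmerStructure ((2 : ℕ) : ℤ)).selmerGroup := by
    rw [← selmerGroup_eq_selmerGroup_kummerSelmerStructure]; exact hfinW
  haveI hfinA : Finite 𝓐.selmerGroup :=
    Nat.finite_of_card_ne_zero (by rw [hSelA]; exact (Nat.card_pos (α := Wd.selmerGroup ((2 : ℕ) : ℤ))).ne')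
  -- the products over `S`
  have hprodA : ∏ v ∈ S, Nat.card (𝓐 v) = 2 ^ T.card := by
    rw [Finset.prod_map, Finset.prod_congr rfl (fun v hv ↦ ?_), Finset.prod_const]
    exact hAv v hv
  have hprodK : ∏ v ∈ S, Nat.card (W.kummerSelmerStructure ((2 : ℕ) : ℤ) v) = 2 ^ T.card := by
    rw [Finset.prod_map, Finset.prod_congr rfl (fun v hv ↦ ?_), Finset.prod_const]
    exact hKv v hv
  have hprodrel : ∏ v ∈ S, (𝓐 v).relIndex (W.kummerSelmerStructure ((2 : ℕ) : ℤ) v) = 2 ^ T.card := by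
    rw [Finset.prod_map, Finset.prod_congr rfl (fun v hv ↦ ?_), Finset.prod_const]
    exact hrel v hv
  refine ⟨?_, ?_, ?_⟩
  · -- `#Sel(Wd) ≤ 2^{#T} · #Sel(W)`
    have h := natCard_selmerGroup_le_mul_prod_of_agree_off W 2 𝓐 (W.kummerSelmerStructure ((2 : ℕ) : ℤ)) S hagree
    rw [hSelA, hSelK, hprodA, mul_comm] at h
    exact h
  · -- `#Sel(W) ≤ 2^{#T} · #Sel(Wd)`
    have h := natCard_selmerGroup_le_mul_prod_of_agree_off W 2 (W.kummerSelmerStructure ((2 : ℕ) : ℤ)) 𝓐 S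
      (fun v hv ↦ (hagree v hv).symm)
    rw [hSelA, hSelK, hprodK, mul_comm] at h
    exact h
  · -- the parity: Kramer's congruence for the framed `φ`
    have h := GenusKolyKramer.isSquare_card_selmerGroup_mul_of_frame W Wd φ (Function.LeftInverse.injective hψφ) π hπ A hA
      𝓐 h𝓐 S hagree
    rw [hprodrel] at h
    exact h

end Multi

end Summit.BirchSwinnertonDyer.BirchSwinnertonDyer.Theorems.GenusKolyTwistLocal

end
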